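import Summits.QuantumFields.BalabanUV.Beta.EriceRemainderEnclosureHistoryAutonomyMonotoneGeneral

/-!
# EriceRemainderEnclosureHistoryAutonomyAsymptoticDiscrepancy — (E44a) ABOVE THE THRESHOLD THE SOLUTIONS ARE CLASSIFIED BY ONE REAL NUMBER:
# for ANY functional with a zeroth moment `M` (any size) and a floor `b > 0` on ]0,γ], any two box solutions `h, h′` of the flow with memory
# `1∕h(m+1)² = 1∕h(m)² + B(h(m+1), h(m+2), …)` from one pin have an ASYMPTOTIC DISCREPANCY `D_∞ = lim_m (1∕h_m² − 1∕h′_m²)` (rate `T∕√m`);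
# ONE SCALE CONTROLS ALL SCALES (`sup_j |D_j| ≤ e^{3M∕(2b√b)}·(|D_n| + T∕√n)`), hence `sup_j |D_j| ≤ e^{3M∕(2b√b)}·|D_∞|` and `D_∞ = 0 ⟺ h = h′`;
# `D_∞` is a COCYCLE, so `h ↦ D_∞(h, h₀)` is INJECTIVE on the solution set, and along agewise-convergent sequences of solutions it is
# CONTINUOUS while the recursion variables converge UNIFORMLY in the scale — the solution set of one flow is a LINE SET

Cell `pub-balaban`, β-function sub-cell, BINDER row D4 «RemainderConst leaves for Bałaban's split» (`HOME/BINDER-OWNERS.md`; owner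
lineage `b2b-balaban-beta-an4`; this file by co-owner #2 lineage `b2b-balaban-beta-d4-p2`, generation 41), β-FLOW TEAM duty (1),
FREEZE (0) honoured (def-free module in the lineage's `EriceRemainderEnclosure*` series; no new leaf, no new hypothesis shape; (E43a)
`…HistoryAutonomyDiscrepancy.abs_disc_le_K` and (E43b) `…HistoryAutonomyMonotoneGeneral.abs_disc_le_C_mul_of_tail` ∕ `abs_disc_sub_disc_le_tail`
BY NAME).  Sequel of (E43): there the boundedness, the downward contraction and the Cauchy tail of the discrepancy served ONE uniqueness
theorem (monotone memory); here they are read as the STRUCTURE of the solution set when uniqueness FAILS ((E38c): it fails at every ratio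
`M·γ∕b > 3√3`).

HONEST FRAMING (page 1, verbatim and binding).  *"Discharging BetaPertH makes Bałaban's UV stability UNCONDITIONAL — a real
constructive-QFT result; it is NOT the continuum limit and NOT the Clay problem."*  THIS FILE DISCHARGES NOTHING OF THE KIND.  It is
elementary real analysis (Cauchy sequences in `ℝ`, `ε∕2`-arguments) about an ABSTRACT functional `B : (ℕ → ℝ) → ℝ` with a displayed zeroth
moment and floor.  Which modulus [I]'s (1.22) limit functional has in the preceding couplings is NOT PRINTED (GAPS G-t4-U2-1 ∕ G-t4-U2-2;
[I] p. 298 qualitative) and is not asserted; whether Bałaban's flow sits above or below the threshold is not asserted.  Row D4 class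
UNCHANGED (critical-path width 0; instance 0∕1; D4 DISCHARGE NO DATE).  HONEST DEPENDENCY: continuum YM on T⁴ ⇐ BetaPertH ∧ nine spine
estimates (0/9 proved); BetaPertH ⇐ (D1) ∧ (D4) ∧ CAP+tail; G-an2-4 gates asym, D1 and NE2/3/4.

THE POINT (census sense (α); the AUTONOMY row above its threshold).  (E38)–(E43) decided WHEN the flow with memory determines the trajectory
from its pin: always for `M·γ ≤ 3√3·b`, always for monotone memory, NOT in general above `3√3` ((E38c)'s tent: two box solutions).  What
does the set of box solutions of ONE flow `(B, g_IR)` look like when it is not a point?  With `D_m = 1∕h_m² − 1∕h′_m²` the discrepancy of two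
solutions, (E43) gives for ANY zeroth-moment functional with floor: `|D_m| ≤ K = 10M³∕(b³√b)`, the Cauchy tail `|D_j − D_n| ≤ T∕√n`
(`T = M·K∕(b√b)`), and NON-MERGING `|D_j| ≤ C·sup_{i≥n}|D_i|` (`C = e^{3M∕(2b√b)}`).  HENCE: (§1) ONE SCALE CONTROLS ALL SCALES —
`|D_j| ≤ C·(|D_n| + T∕√n)` for every `j` and every `n ≥ 1`; `D_m → D_∞` with `|D_n − D_∞| ≤ T∕√n`, `|D_∞| ≤ K`; (§2) `|D_j| ≤ C·|D_∞|` at EVERY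
scale, so `D_∞ = 0 ⟺ h = h′`, distinct solutions have `D_∞ ≠ 0` and an eventually SIGN-DEFINITE discrepancy, and
`|h_j − h′_j| ≤ (c_j³∕2)·C·|D_∞| ≤ (g_IR³∕2)·C·|D_∞|` — in the language of the running coupling: two continuum trajectories with the same
infrared value differ in the ultraviolet, to leading order, by a CONSTANT SHIFT `D_∞` of `1∕g²` (a shift of the scale parameter), and that one
number bounds their distance at every scale; (§3) `D_∞` is a COCYCLE, so for a reference solution `h₀` the map `h ↦ D_∞(h, h₀)` is INJECTIVE
on the solution set (`injOn_limUnder`); (§4) along solutions `h_n → h` converging AGEWISE, `D_∞(h_n, h) → 0`, the recursion variables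
converge UNIFORMLY IN THE SCALE (`sup_j |1∕h_n(j)² − 1∕h(j)²| → 0` — for the couplings (E40) had uniformity from the vanishing envelope; for
the UNBOUNDED recursion variables it is new and specific to solutions of one flow), and the classifying map is continuous.  With (E39)∕(E40)
(compactness in the product topology) the solution set of one flow is homeomorphic to a compact subset of `[−K, K]` — a LINE SET ((E44b)
`…HistoryAutonomySolutionSet`); (E45) `…HistoryAutonomyAntitoneWitness` shows that a nondegenerate INTERVAL occurs (an antitone Markov
functional at every ratio above `3√3`), where (E38c)'s tent gives two points.  AS-PRINTED: nothing — `BetaFlowAsPrinted` records a Markov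
`β_n` and a pointwise limit claim (DELTA D-11); the autonomy row is this cell's NOT-IN-PRINT binder analysis.

WHAT IS PROVED ([folklore] real analysis; 0 `def`, 0 sorry; nothing of [I] asserted).  Binder list throughout: zeroth moment
`|B u − B u′| ≤ M·D` whenever box histories are entrywise `D`-close, `M ≥ 0`, floor `b ≤ B` on the box, `b > 0`, pin `gIR > 0`, box solutions.
 §1 **`abs_disc_le_of_one_scale`**, `cauchySeq_disc`, **`exists_tendsto_disc`**, `tendsto_disc_limUnder`, **`abs_disc_sub_lim_le`** (rate `T∕√n`),
    `abs_lim_le_K`.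
 §2 **`abs_disc_le_C_mul_abs_lim`**, **`eq_of_tendsto_disc_zero`**, `lim_eq_zero_iff_eq`, `lim_ne_zero_of_ne`, **`eventually_sign_definite_of_ne`**,
    `abs_sub_le_weight_mul_abs_lim`, **`abs_sub_le_uniform_mul_abs_lim`**, `abs_lim_le_of_forall_abs_disc_le`.
 §3 `tendsto_disc_of_ref`, **`eq_of_lim_ref_eq`**, **`injOn_limUnder`**.
 §4 `tendsto_disc_scale_of_agewise`, **`eventually_forall_abs_disc_le_of_agewise`** (agewise ⟹ uniform for the recursion variables),
    **`tendsto_lim_of_agewise`**, **`tendsto_limUnder_ref_of_agewise`** (continuity of the classifying map).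
-/

noncomputable section
open Filter Topology Finset

namespace Summit.QuantumFields.BalabanUV.Beta.EriceRemainderEnclosureHistoryAutonomyAsymptoticDiscrepancy

open Literature.MathematicalPhysics.QuantumFieldTheory.Balaban1983to89
open Literature.MathematicalPhysics.QuantumFieldTheory.Balaban1983to89.T4BetaStationary
open Literature.MathematicalPhysics.QuantumFieldTheory.Balaban1983to89.T4BetaFlowWellPosed
open Summit.QuantumFields.BalabanUV.Beta.EriceRemainderEnclosureHistoryAutonomyThreshold
open Summit.QuantumFields.BalabanUV.Beta.EriceRemainderEnclosureHistoryAutonomyDiscrepancy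
open Summit.QuantumFields.BalabanUV.Beta.EriceRemainderEnclosureHistoryAutonomyMonotoneGeneral

variable {B : (ℕ → ℝ) → ℝ} {M γ b gIR : ℝ} {h h' h₀ : ℕ → ℝ}

/-! ## §1 One scale controls all scales; the asymptotic discrepancy exists, with the rate `T∕√n` -/

/-- **ONE SCALE CONTROLS ALL SCALES**: for two box solutions from one pin and every `n ≥ 1`,
`|1∕h_j² − 1∕h′_j²| ≤ e^{3M∕(2b√b)}·(|1∕h_n² − 1∕h′_n²| + T∕√n)` at EVERY scale `j`, `T = M·K∕(b√b)`, `K = 10M³∕(b³√b)` — the Cauchy tail puts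
the whole ultraviolet tail within `T∕√n` of the value at scale `n`, and non-merging transports it down. [folklore] -/
theorem abs_disc_le_of_one_scale
    (hB : ∀ u u' : ℕ → ℝ, SeqBox γ u → SeqBox γ u' → ∀ D : ℝ, (∀ j, |u j - u' j| ≤ D) → |B u - B u'| ≤ M * D)
    (hM : 0 ≤ M) (hb : 0 < b) (hgIR : 0 < gIR) (hlo : ∀ u, SeqBox γ u → b ≤ B u)
    (hh : SeqBox γ h) (hh' : SeqBox γ h') (hf : MemFlow B gIR h) (hf' : MemFlow B gIR h') {n : ℕ} (hn : 1 ≤ n) (j : ℕ) :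
    |1 / h j ^ 2 - 1 / h' j ^ 2| ≤ Real.exp (3 * M / (2 * (b * Real.sqrt b))) *
      (|1 / h n ^ 2 - 1 / h' n ^ 2| + M * (10 * M ^ 3 / (b ^ 3 * Real.sqrt b)) / (b * Real.sqrt b) / Real.sqrt (n : ℝ)) := by
  have hT0 : 0 ≤ M * (10 * M ^ 3 / (b ^ 3 * Real.sqrt b)) / (b * Real.sqrt b) / Real.sqrt (n : ℝ) := by positivity
  refine abs_disc_le_C_mul_of_tail (n := n) hB hM hb hgIR hlo hh hh' hf hf' (by positivity) (fun i hi => ?_) j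
  have h1 := abs_disc_sub_disc_le_tail hB hM hb hgIR hlo hh hh' hf hf' hn hi
  calc |1 / h i ^ 2 - 1 / h' i ^ 2|
      = |(1 / h n ^ 2 - 1 / h' n ^ 2) + ((1 / h i ^ 2 - 1 / h' i ^ 2) - (1 / h n ^ 2 - 1 / h' n ^ 2))| := by ring_nf
    _ ≤ |1 / h n ^ 2 - 1 / h' n ^ 2| + |(1 / h i ^ 2 - 1 / h' i ^ 2) - (1 / h n ^ 2 - 1 / h' n ^ 2)| := abs_add_le _ _
    _ ≤ _ := add_le_add le_rfl h1

/-- THE DISCREPANCY IS A CAUCHY SEQUENCE (from (E43b)'s tail `|D_j − D_n| ≤ T∕√n`). [folklore] -/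
theorem cauchySeq_disc
    (hB : ∀ u u' : ℕ → ℝ, SeqBox γ u → SeqBox γ u' → ∀ D : ℝ, (∀ j, |u j - u' j| ≤ D) → |B u - B u'| ≤ M * D)
    (hM : 0 ≤ M) (hb : 0 < b) (hgIR : 0 < gIR) (hlo : ∀ u, SeqBox γ u → b ≤ B u)
    (hh : SeqBox γ h) (hh' : SeqBox γ h') (hf : MemFlow B gIR h) (hf' : MemFlow B gIR h') :
    CauchySeq (fun m => 1 / h m ^ 2 - 1 / h' m ^ 2) := by
  set T : ℝ := M * (10 * M ^ 3 / (b ^ 3 * Real.sqrt b)) / (b * Real.sqrt b) with hT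
  have hT0 : 0 ≤ T := by positivity
  refine Metric.cauchySeq_iff'.2 fun ε hε => ?_
  obtain ⟨N, hN⟩ : ∃ N : ℕ, (T / ε) ^ 2 + 1 < N := exists_nat_gt _
  have hN1 : 1 ≤ N := by
    have : (0 : ℝ) < N := by nlinarith [sq_nonneg (T / ε)]
    exact_mod_cast Nat.one_le_iff_ne_zero.2 (by rintro rfl; simp at this)
  have hsN : T / ε < Real.sqrt (N : ℝ) := by
    refine lt_of_lt_of_le ?_ (Real.sqrt_le_sqrt hN.le)
    rw [Real.lt_sqrt (by positivity)]; linarith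
  have hTN : T / Real.sqrt (N : ℝ) < ε := by
    have hs0 : 0 < Real.sqrt (N : ℝ) := Real.sqrt_pos.2 (by exact_mod_cast hN1)
    rw [div_lt_iff₀ hs0]; rw [div_lt_iff₀ hε] at hsN; linarith
  refine ⟨N, fun n hn => ?_⟩
  rw [Real.dist_eq]
  exact (abs_disc_sub_disc_le_tail hB hM hb hgIR hlo hh hh' hf hf' hN1 hn).trans_lt hTN

/-- **THE ASYMPTOTIC DISCREPANCY EXISTS**: `∃ D_∞, 1∕h_m² − 1∕h′_m² → D_∞` for ANY two box solutions of one zeroth-moment flow with floor from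
one pin — no size condition, no monotonicity. [folklore] -/
theorem exists_tendsto_disc
    (hB : ∀ u u' : ℕ → ℝ, SeqBox γ u → SeqBox γ u' → ∀ D : ℝ, (∀ j, |u j - u' j| ≤ D) → |B u - B u'| ≤ M * D)
    (hM : 0 ≤ M) (hb : 0 < b) (hgIR : 0 < gIR) (hlo : ∀ u, SeqBox γ u → b ≤ B u)
    (hh : SeqBox γ h) (hh' : SeqBox γ h') (hf : MemFlow B gIR h) (hf' : MemFlow B gIR h') :
    ∃ d : ℝ, Tendsto (fun m => 1 / h m ^ 2 - 1 / h' m ^ 2) atTop (𝓝 d) :=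
  cauchySeq_tendsto_of_complete (cauchySeq_disc hB hM hb hgIR hlo hh hh' hf hf')

/-- The `limUnder` packaging: `1∕h_m² − 1∕h′_m² → limUnder atTop (1∕h² − 1∕h′²)`. [folklore] -/
theorem tendsto_disc_limUnder
    (hB : ∀ u u' : ℕ → ℝ, SeqBox γ u → SeqBox γ u' → ∀ D : ℝ, (∀ j, |u j - u' j| ≤ D) → |B u - B u'| ≤ M * D)
    (hM : 0 ≤ M) (hb : 0 < b) (hgIR : 0 < gIR) (hlo : ∀ u, SeqBox γ u → b ≤ B u)
    (hh : SeqBox γ h) (hh' : SeqBox γ h') (hf : MemFlow B gIR h) (hf' : MemFlow B gIR h') :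
    Tendsto (fun m => 1 / h m ^ 2 - 1 / h' m ^ 2) atTop
      (𝓝 (limUnder atTop (fun m => 1 / h m ^ 2 - 1 / h' m ^ 2))) :=
  tendsto_nhds_limUnder (exists_tendsto_disc hB hM hb hgIR hlo hh hh' hf hf')

/-- **THE RATE**: `|D_n − D_∞| ≤ T∕√n` for `n ≥ 1`, `T = M·K∕(b√b)` (the Cauchy tail passed to the limit). [folklore] -/
theorem abs_disc_sub_lim_le
    (hB : ∀ u u' : ℕ → ℝ, SeqBox γ u → SeqBox γ u' → ∀ D : ℝ, (∀ j, |u j - u' j| ≤ D) → |B u - B u'| ≤ M * D)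
    (hM : 0 ≤ M) (hb : 0 < b) (hgIR : 0 < gIR) (hlo : ∀ u, SeqBox γ u → b ≤ B u)
    (hh : SeqBox γ h) (hh' : SeqBox γ h') (hf : MemFlow B gIR h) (hf' : MemFlow B gIR h') {d : ℝ}
    (hd : Tendsto (fun m => 1 / h m ^ 2 - 1 / h' m ^ 2) atTop (𝓝 d)) {n : ℕ} (hn : 1 ≤ n) :
    |(1 / h n ^ 2 - 1 / h' n ^ 2) - d| ≤ M * (10 * M ^ 3 / (b ^ 3 * Real.sqrt b)) / (b * Real.sqrt b) / Real.sqrt (n : ℝ) := by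
  have hlim : Tendsto (fun j => |(1 / h j ^ 2 - 1 / h' j ^ 2) - (1 / h n ^ 2 - 1 / h' n ^ 2)|) atTop
      (𝓝 |d - (1 / h n ^ 2 - 1 / h' n ^ 2)|) := (hd.sub_const _).abs
  have := le_of_tendsto hlim (eventually_atTop.2 ⟨n, fun j hj =>
    abs_disc_sub_disc_le_tail hB hM hb hgIR hlo hh hh' hf hf' hn hj⟩)
  rwa [abs_sub_comm] at this

/-- The asymptotic discrepancy is bounded by (E43a)'s `K = 10M³∕(b³√b)`. [folklore] -/
theorem abs_lim_le_K
    (hB : ∀ u u' : ℕ → ℝ, SeqBox γ u → SeqBox γ u' → ∀ D : ℝ, (∀ j, |u j - u' j| ≤ D) → |B u - B u'| ≤ M * D)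
    (hM : 0 ≤ M) (hb : 0 < b) (hgIR : 0 < gIR) (hlo : ∀ u, SeqBox γ u → b ≤ B u)
    (hh : SeqBox γ h) (hh' : SeqBox γ h') (hf : MemFlow B gIR h) (hf' : MemFlow B gIR h') {d : ℝ}
    (hd : Tendsto (fun m => 1 / h m ^ 2 - 1 / h' m ^ 2) atTop (𝓝 d)) :
    |d| ≤ 10 * M ^ 3 / (b ^ 3 * Real.sqrt b) :=
  le_of_tendsto' hd.abs fun m => abs_disc_le_K hB hM hb hgIR hlo hh hh' hf hf' m

/-! ## §2 Non-merging in the limit form: `sup_j |D_j| ≤ C·|D_∞|`, and the dichotomy `D_∞ = 0 ⟺ h = h′` -/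

/-- **NON-MERGING, LIMIT FORM**: `|1∕h_j² − 1∕h′_j²| ≤ e^{3M∕(2b√b)}·|D_∞|` at EVERY scale — the single number `D_∞` bounds the discrepancy of the
recursion variables uniformly over all scales. [folklore] -/
theorem abs_disc_le_C_mul_abs_lim
    (hB : ∀ u u' : ℕ → ℝ, SeqBox γ u → SeqBox γ u' → ∀ D : ℝ, (∀ j, |u j - u' j| ≤ D) → |B u - B u'| ≤ M * D)
    (hM : 0 ≤ M) (hb : 0 < b) (hgIR : 0 < gIR) (hlo : ∀ u, SeqBox γ u → b ≤ B u)
    (hh : SeqBox γ h) (hh' : SeqBox γ h') (hf : MemFlow B gIR h) (hf' : MemFlow B gIR h') {d : ℝ}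
    (hd : Tendsto (fun m => 1 / h m ^ 2 - 1 / h' m ^ 2) atTop (𝓝 d)) (j : ℕ) :
    |1 / h j ^ 2 - 1 / h' j ^ 2| ≤ Real.exp (3 * M / (2 * (b * Real.sqrt b))) * |d| := by
  set C : ℝ := Real.exp (3 * M / (2 * (b * Real.sqrt b))) with hC
  have hC0 : 0 < C := Real.exp_pos _
  refine le_of_forall_pos_le_add fun ε hε => ?_
  have hε' : 0 < ε / C := div_pos hε hC0
  obtain ⟨n, hn⟩ := (Metric.tendsto_atTop.1 hd) (ε / C) hε'
  have htail : ∀ i, n ≤ i → |1 / h i ^ 2 - 1 / h' i ^ 2| ≤ |d| + ε / C := fun i hi => by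
    have := hn i hi
    rw [Real.dist_eq] at this
    calc |1 / h i ^ 2 - 1 / h' i ^ 2| = |d + ((1 / h i ^ 2 - 1 / h' i ^ 2) - d)| := by ring_nf
      _ ≤ |d| + |(1 / h i ^ 2 - 1 / h' i ^ 2) - d| := abs_add_le _ _
      _ ≤ |d| + ε / C := by linarith
  have := abs_disc_le_C_mul_of_tail hB hM hb hgIR hlo hh hh' hf hf' (by positivity) htail j
  have e : C * (|d| + ε / C) = C * |d| + ε := by field_simp
  linarith [e]

/-- **`D_∞ = 0` FORCES EQUALITY**: if the discrepancy of two box solutions tends to `0`, the solutions coincide (non-merging). [folklore] -/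
theorem eq_of_tendsto_disc_zero
    (hB : ∀ u u' : ℕ → ℝ, SeqBox γ u → SeqBox γ u' → ∀ D : ℝ, (∀ j, |u j - u' j| ≤ D) → |B u - B u'| ≤ M * D)
    (hM : 0 ≤ M) (hb : 0 < b) (hgIR : 0 < gIR) (hlo : ∀ u, SeqBox γ u → b ≤ B u)
    (hh : SeqBox γ h) (hh' : SeqBox γ h') (hf : MemFlow B gIR h) (hf' : MemFlow B gIR h')
    (hd : Tendsto (fun m => 1 / h m ^ 2 - 1 / h' m ^ 2) atTop (𝓝 0)) : h = h' := by
  funext j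
  have h1 := abs_disc_le_C_mul_abs_lim hB hM hb hgIR hlo hh hh' hf hf' hd j
  rw [abs_zero, mul_zero] at h1
  have h2 : 1 / h j ^ 2 = 1 / h' j ^ 2 := sub_eq_zero.1 (abs_nonpos_iff.1 h1)
  have h3 : h j ^ 2 = h' j ^ 2 := by
    have := congrArg (fun x : ℝ => 1 / x) h2
    simpa only [one_div_one_div] using this
  exact (pow_left_inj₀ (hh j).1.le (hh' j).1.le two_ne_zero).1 h3

/-- **THE DICHOTOMY**: `D_∞ = 0 ⟺ h = h′`. [folklore] -/
theorem lim_eq_zero_iff_eq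
    (hB : ∀ u u' : ℕ → ℝ, SeqBox γ u → SeqBox γ u' → ∀ D : ℝ, (∀ j, |u j - u' j| ≤ D) → |B u - B u'| ≤ M * D)
    (hM : 0 ≤ M) (hb : 0 < b) (hgIR : 0 < gIR) (hlo : ∀ u, SeqBox γ u → b ≤ B u)
    (hh : SeqBox γ h) (hh' : SeqBox γ h') (hf : MemFlow B gIR h) (hf' : MemFlow B gIR h') {d : ℝ}
    (hd : Tendsto (fun m => 1 / h m ^ 2 - 1 / h' m ^ 2) atTop (𝓝 d)) : d = 0 ↔ h = h' := by
  refine ⟨fun h0 => eq_of_tendsto_disc_zero hB hM hb hgIR hlo hh hh' hf hf' (h0 ▸ hd), ?_⟩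
  rintro rfl
  exact tendsto_nhds_unique hd (by simp only [sub_self]; exact tendsto_const_nhds)

/-- DISTINCT SOLUTIONS HAVE A NONZERO ASYMPTOTIC DISCREPANCY. [folklore] -/
theorem lim_ne_zero_of_ne
    (hB : ∀ u u' : ℕ → ℝ, SeqBox γ u → SeqBox γ u' → ∀ D : ℝ, (∀ j, |u j - u' j| ≤ D) → |B u - B u'| ≤ M * D)
    (hM : 0 ≤ M) (hb : 0 < b) (hgIR : 0 < gIR) (hlo : ∀ u, SeqBox γ u → b ≤ B u)
    (hh : SeqBox γ h) (hh' : SeqBox γ h') (hf : MemFlow B gIR h) (hf' : MemFlow B gIR h') {d : ℝ}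
    (hd : Tendsto (fun m => 1 / h m ^ 2 - 1 / h' m ^ 2) atTop (𝓝 d)) (hne : h ≠ h') : d ≠ 0 :=
  fun h0 => hne ((lim_eq_zero_iff_eq hB hM hb hgIR hlo hh hh' hf hf' hd).1 h0)

/-- **EVENTUALLY SIGN-DEFINITE**: the discrepancy of two DISTINCT box solutions eventually stays within `|D_∞|` of `D_∞ ≠ 0` — so it has the
sign of `D_∞` and stays bounded away from `0` from some scale on: either `1∕h_j² > 1∕h′_j²` (i.e. `h_j < h′_j`) for all large `j`, or the
reverse. [folklore] -/
theorem eventually_sign_definite_of_ne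
    (hB : ∀ u u' : ℕ → ℝ, SeqBox γ u → SeqBox γ u' → ∀ D : ℝ, (∀ j, |u j - u' j| ≤ D) → |B u - B u'| ≤ M * D)
    (hM : 0 ≤ M) (hb : 0 < b) (hgIR : 0 < gIR) (hlo : ∀ u, SeqBox γ u → b ≤ B u)
    (hh : SeqBox γ h) (hh' : SeqBox γ h') (hf : MemFlow B gIR h) (hf' : MemFlow B gIR h') (hne : h ≠ h') :
    (∀ᶠ j in atTop, h j < h' j) ∨ (∀ᶠ j in atTop, h' j < h j) := by
  obtain ⟨d, hd⟩ := exists_tendsto_disc hB hM hb hgIR hlo hh hh' hf hf'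
  have hd0 : d ≠ 0 := lim_ne_zero_of_ne hB hM hb hgIR hlo hh hh' hf hf' hd hne
  have hev : ∀ᶠ j in atTop, |(1 / h j ^ 2 - 1 / h' j ^ 2) - d| < |d| := by
    obtain ⟨n, hn⟩ := (Metric.tendsto_atTop.1 hd) |d| (abs_pos.2 hd0)
    exact eventually_atTop.2 ⟨n, fun j hj => by rw [← Real.dist_eq]; exact hn j hj⟩
  -- `1/x² > 1/y²` with positive `x, y` gives `x < y`
  have hlt : ∀ {x y : ℝ}, 0 < x → 0 < y → 1 / y ^ 2 < 1 / x ^ 2 → x < y := by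
    intro x y hx hy hxy
    by_contra hle
    exact absurd hxy (not_lt.2 (one_div_le_one_div_of_le (pow_pos hy 2) (pow_le_pow_left₀ hy.le (not_lt.1 hle) 2)))
  rcases lt_or_gt_of_ne hd0 with hneg | hpos
  · right
    refine hev.mono fun j hj => ?_
    rw [abs_of_neg hneg] at hj
    have := (abs_lt.1 hj).2
    exact hlt (hh' j).1 (hh j).1 (by linarith)
  · left
    refine hev.mono fun j hj => ?_
    rw [abs_of_pos hpos] at hj
    have := (abs_lt.1 hj).1
    exact hlt (hh j).1 (hh' j).1 (by linarith)

/-- COUPLING FORM, scale by scale: `|h_j − h′_j| ≤ (c_j³∕2)·e^{3M∕(2b√b)}·|D_∞|`, `c_j = (1∕gIR² + j·b)^{−1∕2}` (the half-cube sensitivity). [folklore] -/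
theorem abs_sub_le_weight_mul_abs_lim
    (hB : ∀ u u' : ℕ → ℝ, SeqBox γ u → SeqBox γ u' → ∀ D : ℝ, (∀ j, |u j - u' j| ≤ D) → |B u - B u'| ≤ M * D)
    (hM : 0 ≤ M) (hb : 0 < b) (hgIR : 0 < gIR) (hlo : ∀ u, SeqBox γ u → b ≤ B u)
    (hh : SeqBox γ h) (hh' : SeqBox γ h') (hf : MemFlow B gIR h) (hf' : MemFlow B gIR h') {d : ℝ}
    (hd : Tendsto (fun m => 1 / h m ^ 2 - 1 / h' m ^ 2) atTop (𝓝 d)) (j : ℕ) :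
    |h j - h' j| ≤ (1 / Real.sqrt (1 / gIR ^ 2 + (j : ℝ) * b)) ^ 3 / 2 *
      (Real.exp (3 * M / (2 * (b * Real.sqrt b))) * |d|) :=
  (abs_sub_le_half_cube_disc hb hgIR hlo hh hh' hf hf' j).trans
    (mul_le_mul_of_nonneg_left (abs_disc_le_C_mul_abs_lim hB hM hb hgIR hlo hh hh' hf hf' hd j) (by positivity))

/-- **COUPLING FORM, UNIFORM**: `sup_j |h_j − h′_j| ≤ (g_IR³∕2)·e^{3M∕(2b√b)}·|D_∞|` — two box solutions are uniformly close as soon as their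
asymptotic discrepancy is small. [folklore] -/
theorem abs_sub_le_uniform_mul_abs_lim
    (hB : ∀ u u' : ℕ → ℝ, SeqBox γ u → SeqBox γ u' → ∀ D : ℝ, (∀ j, |u j - u' j| ≤ D) → |B u - B u'| ≤ M * D)
    (hM : 0 ≤ M) (hb : 0 < b) (hgIR : 0 < gIR) (hlo : ∀ u, SeqBox γ u → b ≤ B u)
    (hh : SeqBox γ h) (hh' : SeqBox γ h') (hf : MemFlow B gIR h) (hf' : MemFlow B gIR h') {d : ℝ}
    (hd : Tendsto (fun m => 1 / h m ^ 2 - 1 / h' m ^ 2) atTop (𝓝 d)) (j : ℕ) :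
    |h j - h' j| ≤ gIR ^ 3 / 2 * (Real.exp (3 * M / (2 * (b * Real.sqrt b))) * |d|) := by
  refine (abs_sub_le_weight_mul_abs_lim hB hM hb hgIR hlo hh hh' hf hf' hd j).trans
    (mul_le_mul_of_nonneg_right (div_le_div_of_nonneg_right ?_ (by norm_num)) (by positivity))
  have hc : 1 / Real.sqrt (1 / gIR ^ 2 + (j : ℝ) * b) ≤ gIR := by
    have h1 : 1 / Real.sqrt (1 / gIR ^ 2 + (j : ℝ) * b) ≤ 1 / Real.sqrt (1 / gIR ^ 2) :=
      one_div_sqrt_anti (by positivity) (le_add_of_nonneg_right (mul_nonneg (Nat.cast_nonneg j) hb.le))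
    rwa [one_div_sqrt_one_div_sq hgIR] at h1
  exact pow_le_pow_left₀ (by positivity) hc 3

/-- The other direction of the comparison: `|D_∞| ≤ S` whenever `|D_j| ≤ S` at every scale (so `|D_∞| ≤ sup_j |D_j| ≤ C·|D_∞|`). [folklore] -/
theorem abs_lim_le_of_forall_abs_disc_le {d S : ℝ} (hd : Tendsto (fun m => 1 / h m ^ 2 - 1 / h' m ^ 2) atTop (𝓝 d))
    (hS : ∀ j, |1 / h j ^ 2 - 1 / h' j ^ 2| ≤ S) : |d| ≤ S :=
  le_of_tendsto' hd.abs hS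

/-! ## §3 The cocycle: the solutions of one flow are classified by ONE real number -/

/-- THE COCYCLE: if `D(h,h₀) → d₁` and `D(h′,h₀) → d₂` then `D(h,h′) → d₁ − d₂` (pure algebra of limits; `h₀` is any reference history).
[folklore] -/
theorem tendsto_disc_of_ref {d₁ d₂ : ℝ} (hd₁ : Tendsto (fun m => 1 / h m ^ 2 - 1 / h₀ m ^ 2) atTop (𝓝 d₁))
    (hd₂ : Tendsto (fun m => 1 / h' m ^ 2 - 1 / h₀ m ^ 2) atTop (𝓝 d₂)) :
    Tendsto (fun m => 1 / h m ^ 2 - 1 / h' m ^ 2) atTop (𝓝 (d₁ - d₂)) :=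
  (hd₁.sub hd₂).congr fun m => by ring

/-- **INJECTIVITY OF THE CLASSIFYING NUMBER**: two box solutions with the SAME asymptotic discrepancy against a common reference history
coincide. [folklore] -/
theorem eq_of_lim_ref_eq
    (hB : ∀ u u' : ℕ → ℝ, SeqBox γ u → SeqBox γ u' → ∀ D : ℝ, (∀ j, |u j - u' j| ≤ D) → |B u - B u'| ≤ M * D)
    (hM : 0 ≤ M) (hb : 0 < b) (hgIR : 0 < gIR) (hlo : ∀ u, SeqBox γ u → b ≤ B u)
    (hh : SeqBox γ h) (hh' : SeqBox γ h') (hf : MemFlow B gIR h) (hf' : MemFlow B gIR h') {d : ℝ}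
    (hd₁ : Tendsto (fun m => 1 / h m ^ 2 - 1 / h₀ m ^ 2) atTop (𝓝 d))
    (hd₂ : Tendsto (fun m => 1 / h' m ^ 2 - 1 / h₀ m ^ 2) atTop (𝓝 d)) : h = h' := by
  have := tendsto_disc_of_ref hd₁ hd₂
  rw [sub_self] at this
  exact eq_of_tendsto_disc_zero hB hM hb hgIR hlo hh hh' hf hf' this

/-- **THE SOLUTION SET OF ONE FLOW INJECTS INTO `ℝ`**: for a box solution `h₀` of `(B, g_IR)` the map
`h ↦ lim_m (1∕h_m² − 1∕h₀_m²)` is INJECTIVE on `{h | SeqBox γ h ∧ MemFlow B g_IR h}`. [folklore] -/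
theorem injOn_limUnder
    (hB : ∀ u u' : ℕ → ℝ, SeqBox γ u → SeqBox γ u' → ∀ D : ℝ, (∀ j, |u j - u' j| ≤ D) → |B u - B u'| ≤ M * D)
    (hM : 0 ≤ M) (hb : 0 < b) (hgIR : 0 < gIR) (hlo : ∀ u, SeqBox γ u → b ≤ B u)
    (hh₀ : SeqBox γ h₀) (hf₀ : MemFlow B gIR h₀) :
    Set.InjOn (fun u : ℕ → ℝ => limUnder atTop (fun m => 1 / u m ^ 2 - 1 / h₀ m ^ 2))
      {u | SeqBox γ u ∧ MemFlow B gIR u} := by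
  intro u hu u' hu' heq
  have h1 := tendsto_disc_limUnder hB hM hb hgIR hlo hu.1 hh₀ hu.2 hf₀
  have h2 := tendsto_disc_limUnder hB hM hb hgIR hlo hu'.1 hh₀ hu'.2 hf₀
  simp only at heq
  rw [heq] at h1
  exact eq_of_lim_ref_eq hB hM hb hgIR hlo hu.1 hu'.1 hu.2 hu'.2 h1 h2

/-! ## §4 Agewise convergence of solutions: the recursion variables converge UNIFORMLY; the classifying number is continuous -/

variable {hn : ℕ → ℕ → ℝ}

/-- At a FIXED scale the discrepancy against the agewise limit tends to `0` (continuity of `x ↦ 1∕x²` at `h m > 0`). [folklore] -/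
theorem tendsto_disc_scale_of_agewise (hh : ∀ j, 0 < h j)
    (hpt : ∀ j, Tendsto (fun n => hn n j) atTop (𝓝 (h j))) (m : ℕ) :
    Tendsto (fun n => 1 / hn n m ^ 2 - 1 / h m ^ 2) atTop (𝓝 0) := by
  have h1 : Tendsto (fun n => 1 / hn n m ^ 2) atTop (𝓝 (1 / h m ^ 2)) :=
    tendsto_const_nhds.div ((hpt m).pow 2) (pow_ne_zero 2 (hh m).ne')
  have := h1.sub_const (1 / h m ^ 2)
  rwa [sub_self] at this

/-- **AGEWISE ⟹ UNIFORM FOR THE RECURSION VARIABLES.**  Box solutions `h_n` of ONE flow `(B, g_IR)` converging AGEWISE to a box solution `h`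
have `sup_j |1∕h_n(j)² − 1∕h(j)²| → 0`: for every `ε > 0`, eventually `|1∕h_n(j)² − 1∕h(j)²| ≤ ε` at ALL scales at once — although the
recursion variables themselves are unbounded in the scale (one scale controls all scales, §1). [folklore] -/
theorem eventually_forall_abs_disc_le_of_agewise
    (hB : ∀ u u' : ℕ → ℝ, SeqBox γ u → SeqBox γ u' → ∀ D : ℝ, (∀ j, |u j - u' j| ≤ D) → |B u - B u'| ≤ M * D)
    (hM : 0 ≤ M) (hb : 0 < b) (hgIR : 0 < gIR) (hlo : ∀ u, SeqBox γ u → b ≤ B u)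
    (hhn : ∀ n, SeqBox γ (hn n)) (hfn : ∀ n, MemFlow B gIR (hn n)) (hh : SeqBox γ h) (hf : MemFlow B gIR h)
    (hpt : ∀ j, Tendsto (fun n => hn n j) atTop (𝓝 (h j))) {ε : ℝ} (hε : 0 < ε) :
    ∀ᶠ n in atTop, ∀ j, |1 / hn n j ^ 2 - 1 / h j ^ 2| ≤ ε := by
  set C : ℝ := Real.exp (3 * M / (2 * (b * Real.sqrt b))) with hC
  have hC0 : 0 < C := Real.exp_pos _
  set T : ℝ := M * (10 * M ^ 3 / (b ^ 3 * Real.sqrt b)) / (b * Real.sqrt b) with hT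
  have hT0 : 0 ≤ T := by positivity
  -- a scale `m ≥ 1` with `C·T∕√m ≤ ε∕2`
  obtain ⟨m, hm⟩ : ∃ m : ℕ, (2 * C * T / ε) ^ 2 + 1 < m := exists_nat_gt _
  have hm1 : 1 ≤ m := by
    have : (0 : ℝ) < m := by nlinarith [sq_nonneg (2 * C * T / ε)]
    exact_mod_cast Nat.one_le_iff_ne_zero.2 (by rintro rfl; simp at this)
  have hs0 : 0 < Real.sqrt (m : ℝ) := Real.sqrt_pos.2 (by exact_mod_cast hm1)
  have hsm : 2 * C * T / ε < Real.sqrt (m : ℝ) := by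
    refine lt_of_lt_of_le ?_ (Real.sqrt_le_sqrt hm.le)
    rw [Real.lt_sqrt (by positivity)]; linarith
  have hCT : C * (T / Real.sqrt (m : ℝ)) ≤ ε / 2 := by
    rw [div_lt_iff₀ hε] at hsm
    rw [mul_div_assoc', div_le_iff₀ hs0]
    linarith
  -- at that scale the discrepancy is eventually below `ε∕(2C)`
  have hev := (Metric.tendsto_atTop.1 (tendsto_disc_scale_of_agewise (fun j => (hh j).1) hpt m)) (ε / (2 * C)) (by positivity)
  obtain ⟨N, hN⟩ := hev
  refine eventually_atTop.2 ⟨N, fun n hNn j => ?_⟩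
  have h1 := abs_disc_le_of_one_scale hB hM hb hgIR hlo (hhn n) hh (hfn n) hf hm1 j
  have h2 : |1 / hn n m ^ 2 - 1 / h m ^ 2| < ε / (2 * C) := by
    have := hN n hNn; rwa [Real.dist_eq, sub_zero] at this
  have e : C * (ε / (2 * C)) = ε / 2 := by field_simp
  calc |1 / hn n j ^ 2 - 1 / h j ^ 2| ≤ C * (|1 / hn n m ^ 2 - 1 / h m ^ 2| + T / Real.sqrt (m : ℝ)) := h1
    _ = C * |1 / hn n m ^ 2 - 1 / h m ^ 2| + C * (T / Real.sqrt (m : ℝ)) := by ring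
    _ ≤ C * (ε / (2 * C)) + ε / 2 := add_le_add (mul_le_mul_of_nonneg_left h2.le hC0.le) hCT
    _ = ε := by rw [e]; ring

/-- **THE ASYMPTOTIC DISCREPANCY AGAINST THE AGEWISE LIMIT TENDS TO `0`**: with `D_∞(h_n, h) = lim_m (1∕h_n(m)² − 1∕h(m)²)`,
`D_∞(h_n, h) → 0` (the rate `T∕√m` is uniform in `n`; one fixed scale does the rest). [folklore] -/
theorem tendsto_lim_of_agewise
    (hB : ∀ u u' : ℕ → ℝ, SeqBox γ u → SeqBox γ u' → ∀ D : ℝ, (∀ j, |u j - u' j| ≤ D) → |B u - B u'| ≤ M * D)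
    (hM : 0 ≤ M) (hb : 0 < b) (hgIR : 0 < gIR) (hlo : ∀ u, SeqBox γ u → b ≤ B u)
    (hhn : ∀ n, SeqBox γ (hn n)) (hfn : ∀ n, MemFlow B gIR (hn n)) (hh : SeqBox γ h) (hf : MemFlow B gIR h)
    (hpt : ∀ j, Tendsto (fun n => hn n j) atTop (𝓝 (h j))) {dn : ℕ → ℝ}
    (hdn : ∀ n, Tendsto (fun m => 1 / hn n m ^ 2 - 1 / h m ^ 2) atTop (𝓝 (dn n))) :
    Tendsto dn atTop (𝓝 0) := by
  refine Metric.tendsto_atTop.2 fun ε hε => ?_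
  obtain ⟨N, hN⟩ := eventually_atTop.1
    (eventually_forall_abs_disc_le_of_agewise hB hM hb hgIR hlo hhn hfn hh hf hpt (half_pos hε))
  refine ⟨N, fun n hNn => ?_⟩
  rw [Real.dist_eq, sub_zero]
  exact (abs_lim_le_of_forall_abs_disc_le (hdn n) (hN n hNn)).trans_lt (half_lt_self hε)

/-- **CONTINUITY OF THE CLASSIFYING NUMBER**: along box solutions `h_n → h` (agewise) of one flow, for any reference box solution `h₀`,
`lim_m (1∕h_n(m)² − 1∕h₀(m)²) → lim_m (1∕h(m)² − 1∕h₀(m)²)` (the cocycle + `tendsto_lim_of_agewise`). [folklore] -/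
theorem tendsto_limUnder_ref_of_agewise
    (hB : ∀ u u' : ℕ → ℝ, SeqBox γ u → SeqBox γ u' → ∀ D : ℝ, (∀ j, |u j - u' j| ≤ D) → |B u - B u'| ≤ M * D)
    (hM : 0 ≤ M) (hb : 0 < b) (hgIR : 0 < gIR) (hlo : ∀ u, SeqBox γ u → b ≤ B u)
    (hhn : ∀ n, SeqBox γ (hn n)) (hfn : ∀ n, MemFlow B gIR (hn n)) (hh : SeqBox γ h) (hf : MemFlow B gIR h)
    (hh₀ : SeqBox γ h₀) (hf₀ : MemFlow B gIR h₀) (hpt : ∀ j, Tendsto (fun n => hn n j) atTop (𝓝 (h j))) :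
    Tendsto (fun n => limUnder atTop (fun m => 1 / hn n m ^ 2 - 1 / h₀ m ^ 2)) atTop
      (𝓝 (limUnder atTop (fun m => 1 / h m ^ 2 - 1 / h₀ m ^ 2))) := by
  set dn : ℕ → ℝ := fun n => limUnder atTop (fun m => 1 / hn n m ^ 2 - 1 / h₀ m ^ 2) with hdn
  set d : ℝ := limUnder atTop (fun m => 1 / h m ^ 2 - 1 / h₀ m ^ 2) with hd
  have h1 : ∀ n, Tendsto (fun m => 1 / hn n m ^ 2 - 1 / h₀ m ^ 2) atTop (𝓝 (dn n)) := fun n =>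
    tendsto_disc_limUnder hB hM hb hgIR hlo (hhn n) hh₀ (hfn n) hf₀
  have h2 : Tendsto (fun m => 1 / h m ^ 2 - 1 / h₀ m ^ 2) atTop (𝓝 d) :=
    tendsto_disc_limUnder hB hM hb hgIR hlo hh hh₀ hf hf₀
  have h3 : ∀ n, Tendsto (fun m => 1 / hn n m ^ 2 - 1 / h m ^ 2) atTop (𝓝 (dn n - d)) := fun n =>
    tendsto_disc_of_ref (h1 n) h2
  have h5 := (tendsto_lim_of_agewise hB hM hb hgIR hlo hhn hfn hh hf hpt h3).add_const d
  rw [zero_add] at h5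
  exact h5.congr fun n => by ring

end Summit.QuantumFields.BalabanUV.Beta.EriceRemainderEnclosureHistoryAutonomyAsymptoticDiscrepancy

end
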